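import Literature.AlgebraicTopology.SingularHomology.LocalDegreeOfDeformation
import Literature.Topology.FourManifolds.ComplexProjectiveSpaceOrientationProofs
import Mathlib.Analysis.Analytic.Order
import Mathlib.RingTheory.RootsOfUnity.Complex
import HarnessLib

/-!
# The local degree of a holomorphic function at a zero of order `n` is `n`

Topic `Literature/AlgebraicTopology/SingularHomology`, a sequel to `…LocalDegreeOfDeformation` (a
brick for the proof of the named fact
`Literature.Geometry.Symplectic.jSphere_wedgeCount_factorsThroughHomology`).  Everything here is
**proved**; no definition, no named fact.

P. Griffiths, J. Harris, *Principles of Algebraic Geometry* (1978), Ch. 0 §4 ("intersection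
numbers of analytic cycles"): the local intersection number of a holomorphic curve with a
hypersurface `{T = 0}` at an isolated intersection is the order of vanishing of `T` along the
curve — equivalently (J. Milnor, *Topology from the Differentiable Viewpoint* (1965), §6 Thm. 1 and
Lemma 4, and the remark on p. 62 of C. Wendl, *Holomorphic Curves in Low Dimensions* (2018),
§2.2.2: a non-transverse intersection "will always give rise to even more transverse intersections
under a generic perturbation"): the LOCAL DEGREE at `z₀` of a holomorphic `f` with a zero of order
`n` is `n`, because the deformation `f_t(w) = ((w - z₀)ⁿ - t sⁿ) h(w)` of `f = (· - z₀)ⁿ h` splits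
the zero into the `n` simple zeros `z₀ + s ζʲ` (`ζ = e^{2πi/n}`), each with complex-linear, hence
orientation preserving (`det_ℝ = |f'|² > 0`), derivative.

* **`HomologicalOrientation.map_localClass_eq_natCast_smul_of_analyticOrderAt`** — for `f : ℂ → ℂ`
  analytic at `z₀` with `analyticOrderAt f z₀ = n ≠ 0`, a `ℤ`-orientation `g` of `ℝ²` and any
  real-linear identification `R : ℂ ≃L[ℝ] ℝ²`: there is `ρ > 0` such that `z₀` is the only zero of
  `f` in `B(z₀, ρ)`, `f` is analytic there, and for every `0 < ρ' ≤ ρ` the push-forward of the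
  local orientation class at `R z₀` (excised to `V = R(B(z₀, ρ'))`) along
  `R ∘ f ∘ R⁻¹ : (V, V ∖ R z₀) → (ℝ², ℝ² ∖ 0)` is `n • g₀` (the statement is quantified over the
  irrelevant openness / continuity / `MapsTo` proofs, in the form consumed by
  `TransverseDiscDatum.functional_ofAbsolute_map_eq_sum_smul`).

## References

* P. Griffiths, J. Harris, *Principles of Algebraic Geometry*, Wiley (1978), Ch. 0 §4.
  [GriffithsHarrisPrinciples1978]
* J. Milnor, *Topology from the Differentiable Viewpoint* (1965), §6 Lemma 4, Thm. 1. [MilnorTDV1965]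
* C. Wendl, *Holomorphic Curves in Low Dimensions*, LNM 2216 (2018), §2.2.2 p. 62. [Wendl2018]
* A. Hatcher, *Algebraic Topology*, CUP (2002), Prop. 2.30, §3.3 p. 233. [HatcherAT2002]
-/

noncomputable section

open CategoryTheory Set Metric Filter Function Complex
open scoped Topology Real
open Literature.Topology.FourManifolds

namespace Literature.AlgebraicTopology.SingularHomology

/-- The real determinant of "multiplication by `a`" on `ℂ`, conjugated by a real-linear
identification `R : ℂ ≃ ℝ²`, is `|a|²` (D'Angelo, *Several Complex Variables and the Geometry of
Real Hypersurfaces* (1993), §1.2.3 Lemma 2: `det dF = |det df|²`). [cite: DAngeloSCV1993, §1.2.3 Lemma 2] -/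
theorem det_conj_smulRight_restrictScalars (R : ℂ ≃L[ℝ] EuclideanSpace ℝ (Fin 2)) (a : ℂ) :
    LinearMap.det (((R : ℂ →L[ℝ] EuclideanSpace ℝ (Fin 2)).comp
        ((((1 : ℂ →L[ℂ] ℂ).smulRight a).restrictScalars ℝ).comp
          (R.symm : EuclideanSpace ℝ (Fin 2) →L[ℝ] ℂ)) : EuclideanSpace ℝ (Fin 2) →L[ℝ] EuclideanSpace ℝ (Fin 2)) :
      EuclideanSpace ℝ (Fin 2) →ₗ[ℝ] EuclideanSpace ℝ (Fin 2)) = Complex.normSq a := by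
  rw [det_conj_continuousLinearEquiv R, ContinuousLinearMap.coe_restrictScalars, det_restrictScalars_eq_normSq]
  have hM : (((1 : ℂ →L[ℂ] ℂ).smulRight a : ℂ →L[ℂ] ℂ) : ℂ →ₗ[ℂ] ℂ) = a • LinearMap.id := by
    apply LinearMap.ext
    intro z
    simp only [ContinuousLinearMap.coe_coe, ContinuousLinearMap.smulRight_apply, one_apply_eq_self,
      LinearMap.smul_apply, LinearMap.id_apply, smul_eq_mul, mul_comm]
  rw [hM, LinearMap.det_smul, LinearMap.det_id, Module.finrank_self, pow_one, mul_one]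

/-- **The local degree of a holomorphic function at a zero of order `n` is `n`** (Griffiths–Harris
1978, Ch. 0 §4: local intersection number with a hypersurface = order of vanishing; Milnor TDV
§6 Thm. 1 / Lemma 4 for the deformation argument; Wendl 2018, §2.2.2 p. 62).  Let `f : ℂ → ℂ` be
analytic at `z₀` with `analyticOrderAt f z₀ = n ≠ 0`, `g` a `ℤ`-orientation of `ℝ²` and
`R : ℂ ≃L[ℝ] ℝ²` a real-linear identification.  Then there is `ρ > 0` such that `z₀` is the only
zero of `f` in `B(z₀, ρ)`, `f` is analytic on `B(z₀, ρ)`, and for every `0 < ρ' ≤ ρ` the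
push-forward of the local orientation class at `R z₀`, excised to `V = R⁻¹⁻¹(B(z₀, ρ'))`, along
`R ∘ f ∘ R⁻¹ : (V, V ∖ R z₀) → (ℝ², ℝ² ∖ 0)` equals `n • g₀`.  Proof: deform
`f = (· - z₀)ⁿ h` to `((· - z₀)ⁿ - sⁿ) h` (`s = ρ'/2`), whose zeros `z₀ + s ζʲ` are `n` simple
zeros with complex-linear derivatives, `det_ℝ = |·|² > 0`
(`map_localClass_eq_sum_detSign_of_deformation`).
[cite: GriffithsHarrisPrinciples1978, Ch. 0 §4] [cite: MilnorTDV1965, §6 Thm. 1 and Lemma 4]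
[cite: Wendl2018, §2.2.2 p. 62] -/
theorem HomologicalOrientation.map_localClass_eq_natCast_smul_of_analyticOrderAt
    (g : HomologicalOrientation ℤ (EuclideanSpace ℝ (Fin 2)) 2) (R : ℂ ≃L[ℝ] EuclideanSpace ℝ (Fin 2))
    {f : ℂ → ℂ} {z₀ : ℂ} (hf : AnalyticAt ℂ f z₀) {n : ℕ} (hn : analyticOrderAt f z₀ = n) (hn0 : n ≠ 0) :
    ∃ ρ : ℝ, 0 < ρ ∧ (∀ w ∈ ball z₀ ρ, f w = 0 ↔ w = z₀) ∧ (∀ w ∈ ball z₀ ρ, AnalyticAt ℂ f w) ∧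
      ∀ ρ' : ℝ, 0 < ρ' → ρ' ≤ ρ →
      ∀ (hV : IsOpen (R.symm ⁻¹' ball z₀ ρ')) (hp : R z₀ ∈ R.symm ⁻¹' ball z₀ ρ')
        (hfc : ContinuousOn (fun x => R (f (R.symm x))) (R.symm ⁻¹' ball z₀ ρ'))
        (hm : MapsTo (fun v : ↥(R.symm ⁻¹' ball z₀ ρ') => R (f (R.symm v)))
          ({(⟨R z₀, hp⟩ : ↥(R.symm ⁻¹' ball z₀ ρ'))}ᶜ : Set _) ({(0 : EuclideanSpace ℝ (Fin 2))}ᶜ)),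
        relativeSingularHomology.map ℤ ℤ
          (⟨fun v : ↥(R.symm ⁻¹' ball z₀ ρ') => R (f (R.symm v)), hfc.restrict⟩ :
            C(↥(R.symm ⁻¹' ball z₀ ρ'), EuclideanSpace ℝ (Fin 2))) hm 2
          ((localHomology.openSubsetIso ℤ ℤ hV hp 2).inv (g.localClass (R z₀))) =
        (n : ℤ) • g.localClass 0 := by
  classical
  obtain ⟨h, hh, hh0, hfh⟩ := hf.analyticOrderAt_eq_natCast.mp hn
  -- a ball on which `f = (· - z₀)ⁿ h`, `h` analytic and non-vanishing, `f` analytic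
  have hev : ∀ᶠ w in 𝓝 z₀, f w = (w - z₀) ^ n * h w ∧ AnalyticAt ℂ h w ∧ h w ≠ 0 ∧ AnalyticAt ℂ f w := by
    filter_upwards [hfh, hh.eventually_analyticAt, hh.continuousAt.eventually_ne hh0,
      hf.eventually_analyticAt] with w h1 h2 h3 h4
    exact ⟨by simpa only [smul_eq_mul] using h1, h2, h3, h4⟩
  obtain ⟨ρ, hρ, hball⟩ := Metric.eventually_nhds_iff_ball.mp hev
  refine ⟨ρ, hρ, fun w hw => ?_, fun w hw => (hball w hw).2.2.2, ?_⟩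
  · rw [(hball w hw).1, mul_eq_zero, pow_eq_zero_iff hn0, sub_eq_zero, or_iff_left (hball w hw).2.2.1]
  intro ρ' hρ' hρ'ρ hV hp hfc hm
  haveI : NeZero n := ⟨hn0⟩
  -- notation
  set O : Set (EuclideanSpace ℝ (Fin 2)) := R.symm ⁻¹' ball z₀ ρ' with hO_def
  have hOball : ∀ x ∈ O, R.symm x ∈ ball z₀ ρ := fun x hx => ball_subset_ball hρ'ρ hx
  have hOball' : ∀ x ∈ O, R.symm x ∈ ball z₀ ρ' := fun x hx => hx
  set s : ℝ := ρ' / 2 with hs_def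
  have hs : 0 < s := by positivity
  have hsρ' : s < ρ' := by rw [hs_def]; linarith
  have hs0 : (s : ℂ) ≠ 0 := ofReal_ne_zero.2 hs.ne'
  -- the deformation `Φ t w = ((w - z₀)ⁿ - t sⁿ) h w`, read in `ℝ²` through `R`
  set c : ℝ → ℂ := fun t => ((t * s ^ n : ℝ) : ℂ) with hc_def
  have hc0 : c 0 = 0 := by simp [hc_def]
  have hc1 : c 1 = (s : ℂ) ^ n := by simp [hc_def]
  set Φ : ℝ → ℂ → ℂ := fun t w => ((w - z₀) ^ n - c t) * h w with hΦ_def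
  obtain ⟨F, hF_def⟩ : ∃ F : ℝ → EuclideanSpace ℝ (Fin 2) → EuclideanSpace ℝ (Fin 2),
      ∀ t x, F t x = R (Φ t (R.symm x)) := ⟨fun t x => R (Φ t (R.symm x)), fun _ _ => rfl⟩
  -- the compact set containing all the zeros
  set K : Set (EuclideanSpace ℝ (Fin 2)) := R '' closedBall z₀ s with hK_def
  have hK : IsCompact K := (isCompact_closedBall z₀ s).image R.continuous
  have hKO : K ⊆ O := by
    rintro _ ⟨w, hw, rfl⟩
    change R.symm (R w) ∈ ball z₀ ρ'
    rw [R.symm_apply_apply]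
    exact closedBall_subset_ball hsρ' hw
  -- continuity
  have hcont_h : ContinuousOn h (ball z₀ ρ) := fun w hw => (hball w hw).2.1.continuousAt.continuousWithinAt
  have hF : ContinuousOn (fun q : ℝ × EuclideanSpace ℝ (Fin 2) => F q.1 q.2) (univ ×ˢ O) := by
    have h1 : ContinuousOn (fun q : ℝ × EuclideanSpace ℝ (Fin 2) => h (R.symm q.2)) (univ ×ˢ O) :=
      hcont_h.comp (R.symm.continuous.comp continuous_snd).continuousOn (fun q hq => hOball q.2 hq.2)
    have h2 : Continuous (fun q : ℝ × EuclideanSpace ℝ (Fin 2) => (R.symm q.2 - z₀) ^ n - c q.1) :=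
      (((R.symm.continuous.comp continuous_snd).sub continuous_const).pow n).sub
        (continuous_ofReal.comp (continuous_fst.mul continuous_const))
    have h3 : (fun q : ℝ × EuclideanSpace ℝ (Fin 2) => F q.1 q.2) =
        fun q => R (((R.symm q.2 - z₀) ^ n - c q.1) * h (R.symm q.2)) := funext fun q => hF_def q.1 q.2
    rw [h3]
    exact R.continuous.comp_continuousOn (h2.continuousOn.mul h1)
  have hcontO : ∀ t : ℝ, ContinuousOn (F t) O := by
    intro t
    have h1 : ContinuousOn (fun x : EuclideanSpace ℝ (Fin 2) => h (R.symm x)) O :=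
      hcont_h.comp R.symm.continuous.continuousOn (fun x hx => hOball x hx)
    have h2 : Continuous (fun x : EuclideanSpace ℝ (Fin 2) => (R.symm x - z₀) ^ n - c t) :=
      ((R.symm.continuous.sub continuous_const).pow n).sub continuous_const
    have h3 : F t = fun x => R (((R.symm x - z₀) ^ n - c t) * h (R.symm x)) := funext fun x => hF_def t x
    rw [h3]
    exact R.continuous.comp_continuousOn (h2.continuousOn.mul h1)
  -- zeros at time `t ∈ [0, 1]` lie in `K`
  have hzero : ∀ t x, x ∈ O → F t x = 0 → (R.symm x - z₀) ^ n = c t := by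
    intro t x hx h0
    rw [hF_def] at h0
    have h1 : Φ t (R.symm x) = 0 := (map_eq_zero_iff R R.injective).1 h0
    have h2 : (R.symm x - z₀) ^ n - c t = 0 :=
      (mul_eq_zero.1 h1).resolve_right (hball _ (hOball x hx)).2.2.1
    exact sub_eq_zero.1 h2
  have hFK : ∀ t ∈ Icc (0 : ℝ) 1, ∀ x ∈ O, F t x = 0 → x ∈ K := by
    intro t ht x hx h0
    have h1 := hzero t x hx h0
    have h2 : ‖R.symm x - z₀‖ ^ n ≤ s ^ n := by
      have := congrArg norm h1
      rw [norm_pow] at this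
      rw [this, hc_def]
      change ‖((t * s ^ n : ℝ) : ℂ)‖ ≤ s ^ n
      rw [norm_real, Real.norm_eq_abs, abs_of_nonneg (mul_nonneg ht.1 (pow_nonneg hs.le n))]
      calc t * s ^ n ≤ 1 * s ^ n := by gcongr; exact ht.2
        _ = s ^ n := one_mul _
    have h3 : ‖R.symm x - z₀‖ ≤ s := (pow_le_pow_iff_left₀ (norm_nonneg _) hs.le hn0).1 h2
    refine ⟨R.symm x, ?_, R.apply_symm_apply x⟩
    rwa [mem_closedBall, dist_eq_norm]
  -- time `0`: the only zero is `R z₀`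
  have hp0 : F 0 (R z₀) = 0 := by
    rw [hF_def]
    simp only [hΦ_def, R.symm_apply_apply, sub_self, zero_pow hn0, hc0, zero_mul, map_zero]
  have h0 : MapsTo (fun y : ↥O => F 0 y) {(⟨R z₀, hp⟩ : ↥O)}ᶜ ({0}ᶜ : Set (EuclideanSpace ℝ (Fin 2))) := by
    intro y hy hy0
    apply hy
    have h1 := hzero 0 y y.2 hy0
    rw [hc0, pow_eq_zero_iff hn0, sub_eq_zero] at h1
    apply Subtype.ext
    change (y : EuclideanSpace ℝ (Fin 2)) = R z₀
    rw [← h1, R.apply_symm_apply]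
  -- time `1`: the `n` simple zeros `z₀ + s ζʲ`
  set ζ : ℂ := exp (2 * π * I / n) with hζ_def
  have hζ : IsPrimitiveRoot ζ n := Complex.isPrimitiveRoot_exp n hn0
  have hζ1 : ‖ζ‖ = 1 := hζ.norm'_eq_one hn0
  have hζn : ∀ j : ℕ, (ζ ^ j) ^ n = 1 := fun j => by
    rw [← pow_mul, mul_comm, pow_mul, hζ.pow_eq_one, one_pow]
  set root : Fin n → ℂ := fun j => z₀ + s * ζ ^ (j : ℕ) with hroot_def
  have hroot_ball : ∀ j, root j ∈ ball z₀ ρ' := fun j => by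
    rw [mem_ball, dist_eq_norm, hroot_def]
    simp only [add_sub_cancel_left, Complex.norm_mul, norm_real, Real.norm_eq_abs, norm_pow, hζ1,
      one_pow, mul_one, abs_of_pos hs]
    exact hsρ'
  have hroot_inj : Injective fun j : Fin n => R (root j) := by
    intro j l hjl
    have h1 : root j = root l := R.injective hjl
    simp only [hroot_def, add_right_inj, mul_eq_mul_left_iff, hs0, or_false] at h1
    exact Fin.ext (hζ.pow_inj j.2 l.2 h1)
  set Z : Finset (EuclideanSpace ℝ (Fin 2)) := Finset.univ.image fun j : Fin n => R (root j) with hZ_def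
  have hZcard : Z.card = n := by
    rw [hZ_def, Finset.card_image_of_injective _ hroot_inj, Finset.card_univ, Fintype.card_fin]
  have hZO : (↑Z : Set (EuclideanSpace ℝ (Fin 2))) ⊆ O := by
    intro x hx
    obtain ⟨j, -, rfl⟩ := Finset.mem_image.1 (Finset.mem_coe.1 hx)
    change R.symm (R (root j)) ∈ ball z₀ ρ'
    rw [R.symm_apply_apply]
    exact hroot_ball j
  have hZ : ∀ x ∈ O, F 1 x = 0 ↔ x ∈ Z := by
    intro x hx
    constructor
    · intro h0
      have h1 := hzero 1 x hx h0
      rw [hc1] at h1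
      have h2 : ((R.symm x - z₀) / s) ^ n = 1 := by
        rw [div_pow, h1, div_self (pow_ne_zero n hs0)]
      obtain ⟨i, hi, hζi⟩ := hζ.eq_pow_of_pow_eq_one h2
      have h3 : R.symm x = root ⟨i, hi⟩ := by
        rw [hroot_def]
        change R.symm x = z₀ + s * ζ ^ i
        rw [hζi, mul_div_cancel₀ _ hs0, add_sub_cancel]
      rw [hZ_def, Finset.mem_image]
      exact ⟨⟨i, hi⟩, Finset.mem_univ _, by rw [← h3, R.apply_symm_apply]⟩
    · intro hxZ
      obtain ⟨j, -, rfl⟩ := Finset.mem_image.1 hxZ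
      rw [hF_def]
      simp only [hΦ_def, R.symm_apply_apply, hc1]
      have : (root j - z₀) ^ n - (s : ℂ) ^ n = 0 := by
        rw [hroot_def]
        change (z₀ + s * ζ ^ (j : ℕ) - z₀) ^ n - (s : ℂ) ^ n = 0
        rw [add_sub_cancel_left, mul_pow, hζn, mul_one, sub_self]
      rw [this, zero_mul, map_zero]
  -- the derivatives at time `1`
  set a : EuclideanSpace ℝ (Fin 2) → ℂ := fun x =>
    (n : ℂ) * (R.symm x - z₀) ^ (n - 1) * 1 * h (R.symm x) + ((R.symm x - z₀) ^ n - c 1) * deriv h (R.symm x)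
    with ha_def
  set A : EuclideanSpace ℝ (Fin 2) → (EuclideanSpace ℝ (Fin 2) →L[ℝ] EuclideanSpace ℝ (Fin 2)) := fun x =>
    (R : ℂ →L[ℝ] EuclideanSpace ℝ (Fin 2)).comp
      ((((1 : ℂ →L[ℂ] ℂ).smulRight (a x)).restrictScalars ℝ).comp
        (R.symm : EuclideanSpace ℝ (Fin 2) →L[ℝ] ℂ)) with hA_def
  have hdetA : ∀ x, LinearMap.det (A x : EuclideanSpace ℝ (Fin 2) →ₗ[ℝ] EuclideanSpace ℝ (Fin 2)) =
      Complex.normSq (a x) := fun x => det_conj_smulRight_restrictScalars R (a x)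
  have hA : ∀ z ∈ Z, HasFDerivAt (F 1) (A z) z := by
    intro z hz
    have hw : R.symm z ∈ ball z₀ ρ := hOball z (hZO hz)
    have hd : HasDerivAt (Φ 1) (a z) (R.symm z) := by
      have h1 : HasDerivAt (fun w => (w - z₀) ^ n - c 1) ((n : ℂ) * (R.symm z - z₀) ^ (n - 1) * 1) (R.symm z) :=
        (((hasDerivAt_id _).sub_const z₀).pow n).sub_const (c 1)
      have h2 : HasDerivAt h (deriv h (R.symm z)) (R.symm z) := (hball _ hw).2.1.differentiableAt.hasDerivAt
      exact h1.mul h2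
    have h3 : F 1 = fun x => R (Φ 1 (R.symm x)) := funext fun x => hF_def 1 x
    rw [h3]
    exact R.hasFDerivAt.comp z ((hd.hasFDerivAt.restrictScalars ℝ).comp z R.symm.hasFDerivAt)
  have ha_ne : ∀ z ∈ Z, a z ≠ 0 := by
    intro z hz
    obtain ⟨j, -, rfl⟩ := Finset.mem_image.1 hz
    have hw : root j ∈ ball z₀ ρ := ball_subset_ball hρ'ρ (hroot_ball j)
    simp only [ha_def, R.symm_apply_apply, hc1, mul_one]
    have h1 : (root j - z₀) ^ n - (s : ℂ) ^ n = 0 := by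
      rw [hroot_def]
      change (z₀ + s * ζ ^ (j : ℕ) - z₀) ^ n - (s : ℂ) ^ n = 0
      rw [add_sub_cancel_left, mul_pow, hζn, mul_one, sub_self]
    rw [h1, zero_mul, add_zero]
    have h2 : root j - z₀ = s * ζ ^ (j : ℕ) := by
      rw [hroot_def]; change z₀ + s * ζ ^ (j : ℕ) - z₀ = _; rw [add_sub_cancel_left]
    rw [h2]
    refine mul_ne_zero (mul_ne_zero (Nat.cast_ne_zero.2 hn0) (pow_ne_zero _ (mul_ne_zero hs0
      (pow_ne_zero _ (hζ.ne_zero hn0))))) (hball _ hw).2.2.1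
  have hdet_pos : ∀ z ∈ Z, 0 < LinearMap.det (A z : EuclideanSpace ℝ (Fin 2) →ₗ[ℝ] EuclideanSpace ℝ (Fin 2)) :=
    fun z hz => by rw [hdetA]; exact Complex.normSq_pos.2 (ha_ne z hz)
  have hdet : ∀ z ∈ Z, LinearMap.det (A z : EuclideanSpace ℝ (Fin 2) →ₗ[ℝ] EuclideanSpace ℝ (Fin 2)) ≠ 0 :=
    fun z hz => (hdet_pos z hz).ne'
  -- the deformation lemma
  have key := g.map_localClass_eq_sum_detSign_of_deformation (by norm_num) hV hK hKO F hF hFK hp hp0 Z hZ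
    hZO A hA hdet (hcontO 0) h0
  have hsum : (∑ z ∈ Z, (if 0 < LinearMap.det (A z : EuclideanSpace ℝ (Fin 2) →ₗ[ℝ] EuclideanSpace ℝ (Fin 2))
      then (1 : ℤ) else -1)) = n := by
    rw [Finset.sum_congr rfl (fun z hz => if_pos (hdet_pos z hz)), Finset.sum_const, hZcard]
    simp
  -- `F 0 = R ∘ f ∘ R⁻¹` on `O`
  have hcm : (⟨fun v : ↥O => R (f (R.symm v)), hfc.restrict⟩ : C(↥O, EuclideanSpace ℝ (Fin 2))) =
      ⟨fun y : ↥O => F 0 y, (hcontO 0).restrict⟩ := by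
    ext1 v
    change R (f (R.symm v)) = F 0 v
    rw [hF_def, (hball _ (hOball v v.2)).1]
    simp only [hΦ_def, hc0, sub_zero]
  rw [relativeSingularHomology.map_congr ℤ ℤ hcm hm h0 2, key, hsum]

end Literature.AlgebraicTopology.SingularHomology

end
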